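import Mathlib
import HarnessLib
import HarnessLib.Audit
import Summits.QuantumFields.Statement
import Summits.QuantumFields.YangMills.Theses.UnitScaleTilt
import Literature.MathematicalPhysics.QuantumFieldTheory.Balaban1983to89.T3YM3TorusStatement
import Literature.MathematicalPhysics.QuantumFieldTheory.Balaban1983to89.T3FinestHeightTail
import HarnessLib.Audit.Status.Attr

/-!
Route: HistoryWedge

# Route HistoryWedge — Only the history wedge matters - per-plaquette tails where the cut-off is
slaved to the height

LINE (D-0145 ideator seat ym-r3-idea-2 g4, lens «nearmiss»; bears_on LADDER-YM rung R3 = leaf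
`T3YM3TorusStatement.YM3TorusSU2` via
crux stmt-QuantumFields-19936 `UnitScaleTilt.HistoryTailL`; no summit and no rung is proved by this
line). It suffices to show
X = WedgeTailL: for every L and every requested profile floor (b₁, p₁) there is a profile (b₀, p₀)
such that FOR EVERY WINDOW PARAMETER m
(constants may depend on m) and all small γ ≤ γ₁(m), every block-averaged plaquette of height j of
cut-off K lying on the HISTORY WEDGE
K ≤ m·(K − j + 1) — equivalently remaining height i = K − j ≥ K/m − 1, the only heights the parent's
deciding theorem ever inspects —
exceeds Bałaban's threshold θBal(K−j) with Gibbs_K-probability ≤ D·ρ^(K−j), ρ·L³ < 1 (geometric rate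
beating plaquette entropy; nothing
Gaussian, nothing off the wedge). On the wedge every coupling in play is g_(K−j)² = γL^(−(K−j)) ≤
γ·L^(1−K/m) → 0: the obligation never
reaches a fixed physical scale. The residual cruxes are the parent's stmt-19200 / stmt-20520,
restated byte-identically.
Lean: `MinimiserStabilityRegPr → FluctuationComparisonRegPrIntL → WedgeTailL → HistoryTailOfWedge →
Literature.MathematicalPhysics.QuantumFieldTheory.Balaban1983to89.T3YM3TorusStatement.YM3TorusSU2`

## Assembly
Pure logic on top of the parent's deciding theorem: `closes h200 h201 hX hG := UnitScaleTilt.closes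
h200 h201 (hG hX)` (glue10.lean,
certified native) — the support item turns WedgeTailL into (the body of) HistoryTailL, and the two
residual cruxes are the parent's
other two hypotheses (same constants by definitional unfolding). The Assembly item restates the
chain; it is proved in Sketch10.lean
(`assembly_proof`) and is landed as `Theorems/HistoryWedgeAssembly.lean` right after open.

CLOSES_TARGET: closes rung R3 of QuantumFields: Literature.MathematicalPhysics.QuantumFieldTheory.Balaban1983to89.T3YM3TorusStatement.YM3TorusSU2 (D-0061; not the summit Statement) — the deciding theorem of this route concludes that registered leaf instead of the Statement decl `YangMills` (class rung: servable and labelled, never counted as concluding the summit Statement).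

Rationale: WHY THIS LINE. NEAR-MISS WITH A MEASURED DEFICIT IN THE HEIGHT RANGE. The parent's deciding theorem
`UnitScaleTilt.closes` consumes HistoryTailL at ONE
window parameter m := max(m₁, m₂, 1) (m₁, m₂ from the residual cruxes) and the event `histGood θ K
(K/m)` constrains only the heights
i = K − j ≥ ⌊K/m⌋ of runs K and K+1; the reduction
`T3HistoryTailReduction.historyTailAt_of_heightTail` takes a per-height hypothesis for
ALL j ≤ K but its proof (`real_compl_histGood_le_sum`) uses it only for j ∈ range(K − ⌊K/m⌋ + 1).
Yet EVERY per-plaquette lever filed on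
19936 — the owner's Gaussian schema (`T3AveragedTailProfile.historyTailAt_of_perPlaquette`),
FirstExitWindowTailL, LocalUnitStabilityL,
the capped-moment / Rényi / stiffness / two-sided levers, and this seat's OrliczTailL, WindowMGFL
and the route-less floor line — quantifies
`∀ K j, 1 ≤ j ≤ K`, i.e. also the heights i < K/m − 1 where the cut-off is unboundedly deep relative
to the observation scale and the
coupling g_i² = γL^(−i) is merely small, not vanishing: the fixed-physical-scale regime that
Magnen–Rivasseau–Sénéor explicitly exclude by
an infrared cutoff because removing it "would lead to large values of the coupling constant"
[paper:magnen1993-cmp155-mrs-ym4-infrared-cutoff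
p.3; doi:10.1007/bf02097397] and that Bałaban reaches only through the full inductive (α)
representation [Balaban1985UV3, Balaban1988Convergent].
The single input to improve is therefore the QUANTIFIER RANGE: on the wedge (a) each height i meets
only the finitely many cut-offs
K ≤ m(i+1), (b) the lattice volume is polynomial in the inverse coupling at the observation height
(|sites of run K| ≤ L^(3(F.m + m(i+1))) against
β_i = L^i/γ), so an expansion in g_i to a FINITE order k(m) > 3m + 4 with volume-extensive remainder
already beats the plaquette entropy,
where the unrestricted cruxes need volume-UNIFORM (cluster-expansion-grade) control at fixed
coupling; (c) the number of integrated levels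
j ≤ (m−1)(i+1) is slaved to the remaining height. Imported: nothing exotic — the move is reading the
consumer; the attack it enables is
finite-order semiclassical / moderate-deviation analysis in a vanishing coupling (Laplace method
with remainder, sourced free energy on a
polynomial volume). What it does that the listed routes do not: it is the only line whose crux is
FORMALLY WEAKER than every filed
per-plaquette currency at once (each of them ⇒ WedgeTailL by restriction, `example` in
Sketch10.lean; converse false), and it hands every
prover of every sibling line the hypothesis K ≤ m(K−j+1), γ ≤ γ₁(m) for free.

RANKED CRUXES. #2 WedgeTailL (crux) — PER-PLAQUETTE GEOMETRIC RATE ON THE HISTORY WEDGE: ∀ L, b₁, p₁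
∃ b₀ ≥ b₁, p₀ ≥ p₁ (0 < b₀, 2 < p₀) ∀ m > 0 ∃ 0 < γ₁ ≤ 1 ∀ F (F.L = L), 0 < γ ≤ γ₁ ∃ D ≥ 0, 0 ≤ ρ
with ρ·L³ < 1 ∀ K, ∀ 1 ≤ j ≤ K with K ≤ m·(K − j + 1), ∀ plaquettes p of height j: Gibbs_K(θBal(K−j)
≤ dist1(Ū^j(∂p))) ≤ D·ρ^(K−j). [difficulty: XL] (why it might fail: Even on the wedge j ≤
(m−1)(K−j+1) integrated levels sit under the plaquette; for large m (the consumer's m₀(ε,L) may be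
large) a tower of marginally-large finer fields could push the rate above L^(−3(K−j)) uniformly in
γ.) [Balaban1985UV3, Balaban1988Convergent, doi:10.1007/bf02097397]
#3 FluctuationComparisonRegPrIntL (crux) — RESIDUAL (shared item stmt-QuantumFields-20520 of
route-QuantumFields-UnitScaleTilt, restated byte-identically; not this line's lever): the
interior-excised fluctuation comparison of the two RG runs at every co-height. [difficulty: XL] (why
it might fail: Cross-cut-off content unprinted for non-abelian d=3: the King-slack two-run row at
every co-height must come from the (α) record; a failure in the window's body is not rescued by any
excision ratio c<1.) [Balaban1985UV3, King1986, Balaban1988Convergent, Balaban1989LargeFieldII]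
#4 MinimiserStabilityRegPr (crux) — RESIDUAL (shared item stmt-QuantumFields-19200 of
route-QuantumFields-UnitScaleTilt, restated byte-identically; not this line's lever): stability of
the printed regular minimiser across one cut-off step. [difficulty: XL] (why it might fail:
Uniformly over all small V the errors along the printed minimiser (interpolation ≈
B₃²b₀²p(g)²L^(K(5/m−2)), cubic averaging error) must be summable, m ≥ 3; INTERP unprinted, AVG-INEQ
printed only for Federbush's averaging.) [Balaban1985UV3, King1986]
#9 HistoryTailOfWedge (support) — THE GLUE (provable now, M/L): WedgeTailL → the body of
UnitScaleTilt.HistoryTailL. Given (L, b₁, p₁) take (b₀, p₀) from WedgeTailL; given m take γ₁(m); for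
(F, γ) take (D, ρ); re-run the proof of `T3HistoryTailReduction.historyTailAt_of_heightTail` with
the per-height hypothesis restricted to the window (its `htail` is invoked only for j ∈ range(K −
⌊K/m⌋ + 1) of runs K and K+1, and there K' ≤ m(K' − j + 1) since m⌊K/m⌋ ≥ K − m + 1), the union
bound over ≤ 72·L^(3(F.m+K−j)) plaquettes per height (`T3AveragedTailProfile` bookkeeping), the
landed bare tail `T3BareTailProfile.bareTailAt` at j = 0, and the summable envelope w_K = Σ_(i ≥
⌊K/m⌋) 72·D·L^(3F.m)·(ρL³)^i. [difficulty: provable-now] [Balaban1985UV3, King1986]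

TWO-LAYER PLAN. WedgeTailL ⇐ (W1) SHALLOW WEDGE m ≤ 2 (j ≤ K − j + 1: no more averaging steps than
remaining height; the regime where the background-shift
/ Cameron–Martin surgery of crux idea `cameron-martin-surgery` has cross terms O(γL)·p², bounded) →
(W2) WEDGE TRANSFER m → m+1 at the
cost of a smaller γ₁(m+1) and larger D(m+1) (one more band of heights K/(m+1) ≤ i < K/m, each met by
finitely many cut-offs) → glue by
induction on m. Alternatively WedgeTailL ⇐ Gaussian schema on the wedge (bc/WedgeTailL_birth.lean,
stub_wedgeGaussian) → arithmetic
(stub_floorOfWedgeGaussian). Nothing filed now.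

KILL CRITERIA. Refutation of WedgeTailL — a family, an m and a sequence (K_n, j_n) ON THE WEDGE K_n
≤ m(K_n − j_n + 1) along which
Gibbs_(K_n)(θBal(K_n − j_n) ≤ dist1(Ū^(j_n)(∂p)))·L^(3(K_n − j_n)) does not tend to 0 for any
admissible profile — closes the route
`refuted:WedgeTailL` AND refutes every per-plaquette lever on 19936 at once (they all imply it),
leaving only non-union-bound attacks on
HistoryTailL. A proof of 19936 through the parent's (α) lane or any sibling line moots the route
(superseded). Refutation of a residual
crux kills the parent too.

NOT DECOMPOSED YET. The m-induction / Gaussian-on-the-wedge splits (Two-layer plan), the dependence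
of (D, ρ, γ₁) on m, the profile choice (b₀, p₀) (free here:
any admissible profile ≥ (b₁, p₁) serves, the crux may raise it), and the finite-order-expansion
attack (order k(m) > 3m + 4) are deliberately
not items; the j = 0 apex of the wedge is landed (`T3FinestHeightTail`,
`T3BareTailProfile.bareTailAt` — the BC5 rung).

CHEAPEST FALSIFIER. In Lean (run, bc/ files): the probes `WedgeTailL → YM3TorusSU2` and `WedgeTailL
→ UnitScaleTilt.HistoryTailL` by exact?/simp/aesop must
fail and do; `#h21_crux_probe` CLEAN. Instrument row (engines ym-r3-instr, JOB-D-type Monte-Carlo):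
at L = 3, m = 2, cut-offs K = 4..8 and
the wedge heights j ≤ K − j + 1 only, estimate Gibbs_K(θBal(K−j) ≤ dist1(Ū^j(∂p)))·27^(K−j);
WedgeTailL predicts decay in K − j uniformly
in K; growth refutes the key lemma — and the SAME run off the wedge (j = K − 1) measures whether the
restriction is where the difficulty was.

NUMBERS. Window used by `UnitScaleTilt.closes`: n = ⌊K/m⌋, m = max(m₁, m₂, 1); heights inspected: K
− j ≥ n for run K and K + 1 − j ≥ n for run K+1,
both inside K' ≤ m(K' − j + 1) since m⌊K/m⌋ ≥ K − m + 1; couplings on the wedge g_(K−j)² ≤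
γL^(1−K/m); sites of run K: L^(3(F.m+K)) ≤
L^(3(F.m + m(K−j+1))); #plaquettes at height j ≤ 72·L^(3(F.m+K−j)); floor rate needed ρ < L^(−3);
Bałaban's printed rate exp(−¼p(g_j)²)
[Balaban1985UV3 (71) p.273] gives ρ = any L^(−3−δ) once b₀ ≥ 4(3+δ)·log L… via p(g)² ≥ b₀²(1+½i log
L)^2.

DEFINITION REQUESTS. None: the wedge condition is the arithmetic guard `K ≤ m * (K - j + 1)` over
existing declarations.

Novelty: Searches (2026-08-28): rg over the 13 filed levers of Summits/QuantumFields/YangMills/Theses/*.lean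
for `K / m`, `m * (K`, `/ m ≤` inside crux
signatures (0 hits: every per-plaquette crux quantifies ∀ K j, 1 ≤ j ≤ K; only the HistoryTailAt
consumer carries m); lit search --hybrid
"Yang-Mills infrared cutoff construction small coupling all scales large field Magnen Rivasseau
Sénéor" (8; hit 1 = paper:magnen1993-cmp155-mrs-ym4-infrared-cutoff,
read pp.2–3: IR cutoff kept so the coupling stays small at every scale treated); lit galaxy search
"Yang-Mills with an infrared cutoff|YM4 with an
infrared|slaved cutoff|asymptotically free scales only" --star all (0 rows) and "infrared
cutoff|large field region" --star pdf (10 rows, none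
lattice-gauge); earlier this generation: galaxy "stretched exponential tail|Orlicz norm|sub-Weibull"
--star all (24, none gauge), "Statulevičius
condition|moderate deviations|method of cumulants" --star all (22, none gauge); ledger negatives
--problem QuantumFields (7, no tail statement).
Nearest prior art found: doi:10.1007/bf02097397 (paper:magnen1993-cmp155-mrs-ym4-infrared-cutoff) —
YM₄ Schwinger functions with a FIXED infrared
cutoff so that only asymptotically-free scales occur; Balaban1985UV3 (71) — the Gaussian large-field
rate at all heights inside the (α) induction;
in the tree `T3HistoryTailReduction.historyTailAt_of_heightTail` (unrestricted hypothesis,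
window-only use).
Delta: the first line on 19936 that restricts the per-plaquette obligati  [refs: 10.1007/bf02097397, paper:magnen1993-cmp155-mrs-ym4-infrared-cutoff, doi:10.1007/bf02097397]

Barriers (technique_class: regime-restriction, union-bound, semiclassical, rg): - technique_class: regime-restriction, union-bound, semiclassical, rg
- Literature.Barriers.QuantumFields.UVStabilityNonUniqueness: outside — WedgeTailL is a bound under
the fixed Wilson–Gibbs law of each
  cut-off K; no continuum limit or uniqueness is asserted; the leaf is the rung's RECORD statement
reached through the parent's closes.
- Literature.Barriers.QuantumFields.FixedCouplingUltralocality: outside, and this is the point of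
the line — the wedge contains NO fixed
  physical scale (every observation scale has physical size ≤ L^(1−K/m) → 0); nothing is claimed at
fixed coupling.
- Literature.Barriers.QuantumFields.RegularisationDichotomy: outside — one regularisation (Wilson
action, Bałaban averaging with the printed
  ℰp) throughout; no comparison across regularisations.
- Literature.Barriers.QuantumFields.PerturbativeInvisibility: the bet — on the wedge a FINITE
perturbative/semiclassical order with a
  volume-extensive remainder suffices arithmetically (order k(m) > 3m + 4), so the statement is
within reach of asymptotic (not convergent)
  expansions provided the remainder is controlled non-perturbatively; off the wedge it would not be.
- Negatives index: the 7 refuted QuantumFields statements (items 15826, 18944, 14958, 9665, 9494,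
9599, 9603) concern mirror/RP
  families, cut-off Rényi rates and Schwinger-function witnesses; none is a tail bound for averaged
fields; WedgeTailL implies none.

sub-problem: YangMills · status: draft · opened planner-ym-r3-idea-2-g4-0 2026-08-28T13:25:52Z · rev 0 · ledger route-QuantumFields-HistoryWedge
GENERATED by the gate from the ledger (D-0016/17). Provers cite these decls: `theorem foo : Summit.QuantumFields.YangMills.Theses.HistoryWedge.<Decl> := …` in Summits/QuantumFields/YangMills/Theorems/<Name>.lean.
-/

namespace Summit.QuantumFields.YangMills.Theses.HistoryWedge

open scoped BigOperators Topology Manifold Classical MeasureTheory ProbabilityTheory Matrix InnerProductSpace ComplexConjugate ContinuousMap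
open Filter Set Function TopologicalSpace MeasureTheory

attribute [summit_statement] _root_.YangMills
attribute [summit_statement] _root_.Literature.MathematicalPhysics.QuantumFieldTheory.Balaban1983to89.T3YM3TorusStatement.YM3TorusSU2

/-- item stmt-QuantumFields-27959 · crux · rank 2 · open · by planner
why it might fail: Even on the wedge j ≤ (m−1)(K−j+1) integrated levels sit under the plaquette; for large m (the consumer's m₀(ε,L) may be large) a tower of marginally-large finer fields could push the rate above L^(−3(K−j)) uniformly in γ.
sources: Balaban1985UV3, Balaban1988Convergent, doi:10.1007/bf02097397
[crux] PER-PLAQUETTE GEOMETRIC RATE ON THE HISTORY WEDGE: ∀ L, b₁, p₁ ∃ b₀ ≥ b₁, p₀ ≥ p₁ (0 < b₀, 2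
< p₀) ∀ m > 0 ∃ 0 < γ₁ ≤ 1 ∀ F (F.L = L), 0 < γ ≤ γ₁ ∃ D ≥ 0, 0 ≤ ρ with ρ·L³ < 1 ∀ K, ∀ 1 ≤ j ≤ K
with K ≤ m·(K − j + 1), ∀ plaquettes p of height j: Gibbs_K(θBal(K−j) ≤ dist1(Ū^j(∂p))) ≤ D·ρ^(K−j).
[difficulty: XL] -/
@[route_item "route-QuantumFields-HistoryWedge", crux]
def WedgeTailL : Prop :=
  open Literature.MathematicalPhysics.QuantumFieldTheory.Balaban1983to89 Literature.MathematicalPhysics.QuantumFieldTheory.Balaban1983to89.T3ContinuumYM3Torus in ∀ (L : ℕ) (b₁ p₁ : ℝ), ∃ (b₀ p₀ : ℝ), b₁ ≤ b₀ ∧ p₁ ≤ p₀ ∧ 0 < b₀ ∧ 2 < p₀ ∧ ∀ (m : ℕ), 0 < m → ∃ γ₁ : ℝ, 0 < γ₁ ∧ γ₁ ≤ 1 ∧ ∀ (F : T3Family) (γ : ℝ), F.L = L → 0 < γ → γ ≤ γ₁ → ∃ (D ρ : ℝ), 0 ≤ D ∧ 0 ≤ ρ ∧ ρ * (L : ℝ)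 ^ 3 < 1 ∧ ∀ (K j : ℕ), 1 ≤ j → j ≤ K → K ≤ m * (K - j + 1) → ∀ (p : Plaq (F.P K) j), (T3UnitScaleTilt.gibbsK F T3UnitLawDensityEML.ℰp γ K).real {U | T3UnitScaleTilt.θBal F.L γ b₀ p₀ (K - j) ≤ GaugeGroup.dist1 (GaugeField.plaqHol (Averaging.iter (fun i => BlockAveraging.blockAvg (P := F.P K) (j := i) T3UnitLawDensityEML.ℰp) j U) p)} ≤ D * ρ ^ (K - j)

/-- item stmt-QuantumFields-20520 · crux · rank 3 · open · by operator
why it might fail: Cross-cut-off content unprinted for non-abelian d=3: the King-slack two-run row at every co-height must come from the (α) record; a failure in the window's body is not rescued by any excision ratio c<1.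
sources: Balaban1985UV3, King1986, Balaban1988Convergent, Balaban1989LargeFieldII
[crux] K1b-INT (E-INT interior excision of FluctuationComparisonRegPrL, OWNER RULING g22-№3 §B +
ADDENDUM 1; card C8 `edge-band-to-the-tail`): for every L there are an EXCISION RATIO 0 < c ≤ 1 and
THRESHOLDS (b₁, p₁) such that for every profile (b₀, p₀) with b₁ ≤ b₀, p₁ ≤ p₀, 0 < b₀, 2 < p₀ there
is ε₁ > 0 such that for every 0 < ε₀ ≤ ε₁ there is m₀ such that for every m ≥ m₀ there is a
volume-uniform γ₁ > 0 such that for every T3Family F with F.L = L and 0 < γ ≤ γ₁,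
`T3InteriorExcision.FluctuationComparisonRegPrIntAt F γ b₀ p₀ m c ε₀`: a.e. on the SHRUNK window
`PlaqSmall (θBal L γ (c·b₀) p₀ (K/m))` both restricted height densities of runs K and K+1 on the
histGood events at the ORIGINAL profile (b₀, p₀) are positive and log ρ + β·minActionRegPr of the
two runs agree modulo constants κ_K up to summable r_K (same body as FluctuationComparisonRegPrAt;
only the a.e. guard is the c-window). FORMALLY WEAKER than FluctuationComparisonRegPrL (c = 1;
window monotone in b₀: `θBal_mono_b`), NO edge clause (the band {θ(c·b₀)-large, θ(b₀)-small} is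
charged to HistoryTailL, whose profile floor absorbs the rescaling:
`T3InteriorExcision.unitTiltTail_of_interior`), and on the c-window print's χ -/
@[route_item "route-QuantumFields-HistoryWedge", crux]
def FluctuationComparisonRegPrIntL : Prop :=
  open Literature.MathematicalPhysics.QuantumFieldTheory.Balaban1983to89 Literature.MathematicalPhysics.QuantumFieldTheory.Balaban1983to89.T3ContinuumYM3Torus in ∀ (L : ℕ), ∃ (c b₁ p₁ : ℝ), 0 < c ∧ c ≤ 1 ∧ ∀ (b₀ p₀ : ℝ), b₁ ≤ b₀ → p₁ ≤ p₀ → 0 < b₀ → 2 < p₀ → ∃ ε₁ : ℝ, 0 < ε₁ ∧ ∀ (ε₀ : ℝ), 0 < ε₀ → ε₀ ≤ ε₁ → ∃ m₀ : ℕ, ∀ (m : ℕ), m₀ ≤ m → ∃ γ₁ : ℝ, 0 < γ₁ ∧ ∀ (F : T3Family) (γ : ℝ), F.L = L → 0 < γ → γ ≤ γ₁ → T3InteriorExcision.FluctuationComparisonRegPrIntAt F γ b₀ p₀ m c ε₀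

/-- item stmt-QuantumFields-19200 · crux · rank 4 · open · by operator
why it might fail: Uniformly over all small V the errors along the printed minimiser (interpolation ≈ B₃²b₀²p(g)²L^(K(5/m−2)), cubic averaging error) must be summable, m ≥ 3; INTERP unprinted, AVG-INEQ printed only for Federbush's averaging.
sources: Balaban1985UV3, King1986
[crux] K1aR-pr (E-min at the minimum over PRINT'S regular space (6) of Balaban1985Variational IN
FULL — both clauses of (2): small plaquette variables AND small covariant divergence
Balaban1985RegularSpaces (1.9); replaces MinimiserStability stmt-QuantumFields-19822; supersedes
children-v2's plaquette-only MinimiserStabilityReg, which needed the unprinted gap G-K1aR-1 on top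
of [7] Thm 1) — for every block size L there is ε₁(L) > 0 (the uniqueness radius a₀ of
Balaban1985Variational Thm 1, «depends on d and L only») such that for every 0 < ε₀ ≤ ε₁, all
sufficiently large m ≥ m₀(L, ε₀), every profile (b₀, p₀) and all 0 < γ ≤ γ₁(L, ε₀, m, b₀, p₀), every
T3Family F with F.L = L: `MinimiserStabilityRegPrAt F γ b₀ p₀ m ε₀` (tree module
`T3PrintedRegularMinimiser` = `BgStabilityAt` at the printed backgrounds `bgRegPr`/`bgRegPr'`) —
summable r_K ≥ 0 and constants κ_K with, for every K and EVERY θBal(⌊K/m⌋)-small field V on the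
comparison lattice, |β_{K+1}·minActionRegPr_{K+1}(V) − β_K·minActionRegPr_K(V) − κ_K| ≤ r_K (κ
idle), where minActionRegPr_K(V) = inf of the Wilson action over run K's fibre of V ∩ {|U(∂p) − 1| <
ε₀L^{-2(K−⌊K/m⌋)} ∀p} ∩ {‖(D^{1*}_U ∂U)(b)‖ < ε₀L^{-3(K−⌊K/m⌋)} ∀b} (d -/
@[route_item "route-QuantumFields-HistoryWedge", crux]
def MinimiserStabilityRegPr : Prop :=
  open Literature.MathematicalPhysics.QuantumFieldTheory.Balaban1983to89 Literature.MathematicalPhysics.QuantumFieldTheory.Balaban1983to89.T3ContinuumYM3Torus in ∀ (L : ℕ), ∃ ε₁ : ℝ, 0 < ε₁ ∧ ∀ (ε₀ : ℝ), 0 < ε₀ → ε₀ ≤ ε₁ → ∃ m₀ : ℕ, ∀ (m : ℕ), m₀ ≤ m → ∀ (b₀ p₀ : ℝ), 0 < b₀ → 2 < p₀ → ∃ γ₁ : ℝ, 0 < γ₁ ∧ ∀ (F : T3Family) (γ : ℝ), F.L = L → 0 < γ → γ ≤ γ₁ → T3PrintedRegularMinimiser.MinimiserStabilityRegPrAt F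 γ b₀ p₀ m ε₀

/-- item stmt-QuantumFields-27960 · support · rank 9 · closed · proved by Summit.QuantumFields.YangMills.Theorems.HistoryWedgeGlue.historyTailOfWedge_proof (prover) · by planner
sources: Balaban1985UV3, King1986
[support] THE GLUE (provable now, M/L): WedgeTailL → the body of UnitScaleTilt.HistoryTailL. Given
(L, b₁, p₁) take (b₀, p₀) from WedgeTailL; given m take γ₁(m); for (F, γ) take (D, ρ); re-run the
proof of `T3HistoryTailReduction.historyTailAt_of_heightTail` with the per-height hypothesis
restricted to the window (its `htail` is invoked only for j ∈ range(K − ⌊K/m⌋ + 1) of runs K and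
K+1, and there K' ≤ m(K' − j + 1) since m⌊K/m⌋ ≥ K − m + 1), the union bound over ≤
72·L^(3(F.m+K−j)) plaquettes per height (`T3AveragedTailProfile` bookkeeping), the landed bare tail
`T3BareTailProfile.bareTailAt` at j = 0, and the summable envelope w_K = Σ_(i ≥ ⌊K/m⌋)
72·D·L^(3F.m)·(ρL³)^i. [difficulty: provable-now] -/
@[route_item "route-QuantumFields-HistoryWedge", crux]
def HistoryTailOfWedge : Prop :=
  open Literature.MathematicalPhysics.QuantumFieldTheory.Balaban1983to89 Literature.MathematicalPhysics.QuantumFieldTheory.Balaban1983to89.T3ContinuumYM3Torus in WedgeTailL → ∀ (L : ℕ) (b₁ p₁ : ℝ), ∃ (b₀ p₀ : ℝ), b₁ ≤ b₀ ∧ p₁ ≤ p₀ ∧ 0 < b₀ ∧ 2 < p₀ ∧ ∀ (m : ℕ), 0 < m → ∃ γ₁ : ℝ, 0 < γ₁ ∧ ∀ (F : T3Family) (γ : ℝ), F.L = L → 0 < γ → γ ≤ γ₁ → T3UnitScaleTilt.HistoryTailAt F γ b₀ p₀ m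

-- `HistoryTailOfWedge` holds: proved by `Summit.QuantumFields.YangMills.Theorems.HistoryWedgeGlue.historyTailOfWedge_proof` (its module imports this route file, so no `_holds` link can be stated here).

/-- item stmt-QuantumFields-27961 · assembly · rank 1 · closed · proved by Summit.QuantumFields.YangMills.Theorems.historyWedge_assembly (planner) · by planner
sources: King1986, Balaban1985UV3
[assembly] MinimiserStabilityRegPr → FluctuationComparisonRegPrIntL → WedgeTailL →
HistoryTailOfWedge → the leaf YM3TorusSU2 (rung R3; not the summit Statement); proved in
Sketch10.lean (`assembly_proof`, one line from `closes`). -/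
@[route_item "route-QuantumFields-HistoryWedge"]
def Assembly : Prop :=
  MinimiserStabilityRegPr → FluctuationComparisonRegPrIntL → WedgeTailL → HistoryTailOfWedge → Literature.MathematicalPhysics.QuantumFieldTheory.Balaban1983to89.T3YM3TorusStatement.YM3TorusSU2

-- `Assembly` holds: proved by `Summit.QuantumFields.YangMills.Theorems.historyWedge_assembly` (its module imports this route file, so no `_holds` link can be stated here).

/-! D-0027 §2.1 — DECIDING THEOREM (planner-authored via `route open/edit --closes-file`; by planner-ym-r3-idea-2-g4-0 2026-08-28T13:25:52Z):
its hypotheses are this route's items and its conclusion the registered leaf `Literature.MathematicalPhysics.QuantumFieldTheory.Balaban1983to89.T3YM3TorusStatement.YM3TorusSU2` (rung R3, D-0061) (glue_lint), and it elaborates with this file. -/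

@[closes "route-QuantumFields-HistoryWedge"] theorem closes (h200 : MinimiserStabilityRegPr) (h201 : FluctuationComparisonRegPrIntL) (hX : WedgeTailL)
    (hG : HistoryTailOfWedge) :
    Literature.MathematicalPhysics.QuantumFieldTheory.Balaban1983to89.T3YM3TorusStatement.YM3TorusSU2 :=
  Summit.QuantumFields.YangMills.Theses.UnitScaleTilt.closes h200 h201 (hG hX)

end Summit.QuantumFields.YangMills.Theses.HistoryWedge
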